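import Summits.AtomisticToContinuum.Crystallization.Theorems.PalmUnimodularRigidityShellsToBarlowChartTransportSteps1
import Summits.AtomisticToContinuum.Crystallization.Theorems.PalmUnimodularRigidityShellsToBarlowChartTransportSteps2
import Summits.AtomisticToContinuum.Crystallization.Theorems.PalmUnimodularRigidityShellsToBarlowChartTransportSteps3
import Summits.AtomisticToContinuum.Crystallization.Theorems.PalmUnimodularRigidityShellsToBarlowChartTransportSteps4
import Summits.AtomisticToContinuum.Crystallization.Theorems.PalmUnimodularRigidityShellsToBarlowChartTransportSteps5

/-!
# Line `develop-the-model-growth-descent` (crux `ShellsToBarlowChart`, stmt-AtomisticToContinuum-9227): lower caps are carried by the in-layer transports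

Helper lemmas for `stub_transportSystem` (the geometric half of the line): frames `⟨x, t₁, t₂, U⟩`
read in the integer charts `IsZChart` of a good-shell configuration, their transports and the
coherence of the resulting development `frameAt`.  The only metric inputs are the chart transfer
lemma and `bond_nb_iff`; everything else is label combinatorics in `ℤ³` (pattern facts
`TransportPatterns*`).  All `[folklore]` (HalesDSP2012 §1.3 for the two kissing patterns).
-/

noncomputable section

namespace Summit.AtomisticToContinuum.Crystallization.Theorems.PalmUnimodularRigidityShellsToBarlowChart

open Literature.Geometry.DiscreteGeometry Literature.MathematicalPhysics.StatisticalMechanics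
open Summit.AtomisticToContinuum.Crystallization.Theorems.ShellsToBarlowChartNegative

variable {S : Set (EuclideanSpace ℝ (Fin 3))} {ac : (EuclideanSpace ℝ (Fin 3)) → ℝ} {Pc : (EuclideanSpace ℝ (Fin 3)) → Finset (Fin 3 → ℤ)}
  {Ac : (EuclideanSpace ℝ (Fin 3)) → ((EuclideanSpace ℝ (Fin 3)) →ₗᵢ[ℝ] (EuclideanSpace ℝ (Fin 3)))} {nb : (EuclideanSpace ℝ (Fin 3)) → (Fin 3 → ℤ) → (EuclideanSpace ℝ (Fin 3))}

/-- The labelling of a chart is injective on its pattern. [folklore] -/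
theorem nb_inj (hch : ∀ z ∈ S, IsZChart S z (ac z) (Pc z) (Ac z) (nb z)) {x : (EuclideanSpace ℝ (Fin 3))} (hx : x ∈ S) {t t' : Fin 3 → ℤ} (ht : t ∈ Pc x) (ht' : t' ∈ Pc x) (h : nb x t = nb x t') : t = t' :=
  (hch x hx).2.2.2.1.injOn ht ht' h

/-- A label outside the singleton-generated cap: not the generator and not touching it.
[folklore] -/
theorem not_mem_capWithAny_singleton {P : Finset (Fin 3 → ℤ)} {t₁ t₂ μ p : Fin 3 → ℤ}
    (h0 : sqNormInt (p - μ) ≠ 0) (h18 : sqNormInt (p - μ) ≠ 18) :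
    p ∉ capWithAny P t₁ t₂ {μ} := by
  intro hp
  simp only [capWithAny, Finset.mem_filter, Finset.mem_singleton] at hp
  obtain ⟨-, -, m, hm, hcase⟩ := hp
  rw [hm] at hcase
  rcases hcase with h | h
  · apply h0; rw [h, sub_self]; rfl
  · exact h18 h

/-- **Lower reference of the I-step.**  For a valid frame in the admissible regime, the unique
lower-cap label `ℓ` touching `t₁` labels a common neighbour of `x` and `y = nb x t₁` whose label
at `y` lies in the LOWER cap of `Istep` (it is off the new hexagon — it is neither the label of
`nb x t₂` nor that of `nb x (t₁ − t₂)` — and it is neither equal nor adjacent to the transported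
upper reference). [folklore] -/
theorem Istep_lower (hch : ∀ z ∈ S, IsZChart S z (ac z) (Pc z) (Ac z) (nb z)) {x : (EuclideanSpace ℝ (Fin 3))} (hx : x ∈ S)
    {t₁ t₂ : Fin 3 → ℤ} {U : Finset (Fin 3 → ℤ)} (hU : IsFrame (Pc x) t₁ t₂ U)
    (hreg : Pc (nb x t₁) = fcc3Int ∨ Pc x = hcpInt ∨
      (-zlab Pc nb (nb x t₁) x ∈ Pc (nb x t₁) ∧ -zlab Pc nb (nb x t₁) (nb x t₂) ∈ Pc (nb x t₁))) :
    ∃ ℓ ∈ lowerCap (Pc x) t₁ t₂ U, sqNormInt (ℓ - t₁) = 18 ∧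
      (lowerCap (Pc x) t₁ t₂ U).filter (fun e => sqNormInt (e - t₁) = 18) = {ℓ} ∧
      (0 < dist (nb x t₁) (nb x ℓ) ∧ dist (nb x t₁) (nb x ℓ) ≤ 28 / 25) ∧
      sqNormInt (zlab Pc nb (nb x t₁) (nb x ℓ) - zlab Pc nb (nb x t₁) x) = 18 ∧
      zlab Pc nb (nb x t₁) (nb x ℓ) ∈ lowerCap (Pc (nb x t₁)) (Istep Pc nb ⟨x, t₁, t₂, U⟩).t₁
        (Istep Pc nb ⟨x, t₁, t₂, U⟩).t₂ (Istep Pc nb ⟨x, t₁, t₂, U⟩).U := by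
  obtain ⟨hyS, hbxy, hwP, -, hvP, hvnb, hnw, hnv, hDwv, hκ, -, -, -, c₁, hc₁U, hc₁t, -, hbu,
    -, hUeq, -⟩ := Istep_spec hch hx hU hreg
  obtain ⟨h12, hhex, hUP, hoff, c, hcU, hform⟩ := hU
  have hPx := pattern_cases hch hx
  have hPy := pattern_cases hch hyS
  have ht₁ : t₁ ∈ Pc x := hhex (mem_hexLabels_iff.2 (Or.inl rfl))
  have ht₂ : t₂ ∈ Pc x := hhex (mem_hexLabels_iff.2 (Or.inr (Or.inl rfl)))
  have ht12 : t₁ - t₂ ∈ Pc x :=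
    hhex (mem_hexLabels_iff.2 (Or.inr (Or.inr (Or.inr (Or.inr (Or.inr rfl))))))
  have hcP : c ∈ Pc x := hUP hcU
  have hc : c ∉ hexLabels t₁ t₂ := hoff c hcU
  have key : ∃ ℓ ∈ lowerCap (Pc x) t₁ t₂ U, sqNormInt (ℓ - t₁) = 18 ∧
      (lowerCap (Pc x) t₁ t₂ U).filter (fun e => sqNormInt (e - t₁) = 18) = {ℓ} ∧
      ∀ e ∈ U, sqNormInt (e - t₁) = 18 → (sqNormInt (ℓ - e) ≠ 0 ∧ sqNormInt (ℓ - e) ≠ 18) := by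
    rcases hform with hE | hO
    · have hc1 : c - t₁ ∈ Pc x := hUP (by rw [hE]; simp)
      have hc2 : c - t₂ ∈ Pc x := hUP (by rw [hE]; simp)
      rw [hE]
      exact (lowerRef_evenCap (Pc x) hPx t₁ ht₁ t₂ ht₂ c hcP h12 hhex hc hc1 hc2).1
    · have hc1 : c + t₁ ∈ Pc x := hUP (by rw [hO]; simp)
      have hc2 : c + t₂ ∈ Pc x := hUP (by rw [hO]; simp)
      rw [hO]
      exact (lowerRef_oddCap (Pc x) hPx t₁ ht₁ t₂ ht₂ c hcP h12 hhex hc hc1 hc2).1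
  obtain ⟨ℓ, hℓL, hℓt, hfilt, hcross⟩ := key
  obtain ⟨hℓP, hℓhex, -⟩ := mem_lowerCap_iff.1 hℓL
  have hz := nb_mem hch hx hℓP
  have hbz : 0 < dist (nb x t₁) (nb x ℓ) ∧ dist (nb x t₁) (nb x ℓ) ≤ 28 / 25 :=
    (bond_nb_iff hch hx ht₁ hℓP).2 (by rw [sqNormInt_sub_comm]; exact hℓt)
  have hlam := zlab_spec hch hyS hz.1 hbz
  -- distances at `y`
  have Dlamw : sqNormInt (zlab Pc nb (nb x t₁) (nb x ℓ) - zlab Pc nb (nb x t₁) x) = 18 := by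
    rw [transfer_nb_centre hch hx hyS hbxy hℓP hbz]; exact (hch x hx).sqNormInt_eq hℓP
  have Dlamμ : sqNormInt (zlab Pc nb (nb x t₁) (nb x ℓ) - zlab Pc nb (nb x t₁) (nb x c₁)) ≠ 0 ∧
      sqNormInt (zlab Pc nb (nb x t₁) (nb x ℓ) - zlab Pc nb (nb x t₁) (nb x c₁)) ≠ 18 := by
    rw [transfer_nb_nb hch hx hyS hbxy hℓP (hUP hc₁U) hbz hbu]; exact hcross c₁ hc₁U hc₁t
  -- off the new hexagon
  have hK : nb (nb x t₁) (zlab Pc nb (nb x t₁) x - zlab Pc nb (nb x t₁) (nb x t₂)) =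
      nb x (t₁ - t₂) := by
    rw [← hκ]
    exact (zlab_spec hch hyS (nb_mem hch hx ht12).1 ((bond_nb_iff hch hx ht₁ ht12).2
      (dist_hexagon (Pc x) hPx t₁ ht₁ t₂ ht₂ h12 hhex).2.2.2.2.2.1)).2
  have hnothex : zlab Pc nb (nb x t₁) (nb x ℓ) ∉
      hexLabels (Istep Pc nb ⟨x, t₁, t₂, U⟩).t₁ (Istep Pc nb ⟨x, t₁, t₂, U⟩).t₂ := by
    intro hmem
    rcases hex_touching_w_I (Pc (nb x t₁)) hPy _ hwP _ hvP hnw hnv hDwv _ hmem Dlamw with h | h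
    · have e1 : nb x ℓ = nb x t₂ := by rw [← hlam.2, h, hvnb]
      exact hℓhex (by rw [nb_inj hch hx hℓP ht₂ e1]; exact mem_hexLabels_iff.2 (Or.inr (Or.inl rfl)))
    · have e1 : nb x ℓ = nb x (t₁ - t₂) := by rw [← hlam.2, h, hK]
      exact hℓhex (by rw [nb_inj hch hx hℓP ht12 e1]; exact mem_hexLabels_iff.2 (Or.inr (Or.inr (Or.inr (Or.inr (Or.inr rfl))))))
  have hnotU : zlab Pc nb (nb x t₁) (nb x ℓ) ∉ (Istep Pc nb ⟨x, t₁, t₂, U⟩).U := by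
    rw [hUeq]; exact not_mem_capWithAny_singleton Dlamμ.1 Dlamμ.2
  exact ⟨ℓ, hℓL, hℓt, hfilt, hbz, Dlamw, mem_lowerCap_iff.2 ⟨hlam.1, hnothex, hnotU⟩⟩

/-- **Lower reference of the J-step** (the unique lower-cap label touching `t₂`). [folklore] -/
theorem Jstep_lower (hch : ∀ z ∈ S, IsZChart S z (ac z) (Pc z) (Ac z) (nb z)) {x : (EuclideanSpace ℝ (Fin 3))} (hx : x ∈ S)
    {t₁ t₂ : Fin 3 → ℤ} {U : Finset (Fin 3 → ℤ)} (hU : IsFrame (Pc x) t₁ t₂ U)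
    (hreg : Pc (nb x t₂) = fcc3Int ∨ Pc x = hcpInt ∨
      (-zlab Pc nb (nb x t₂) x ∈ Pc (nb x t₂) ∧ -zlab Pc nb (nb x t₂) (nb x t₁) ∈ Pc (nb x t₂))) :
    ∃ ℓ ∈ lowerCap (Pc x) t₁ t₂ U, sqNormInt (ℓ - t₂) = 18 ∧
      (lowerCap (Pc x) t₁ t₂ U).filter (fun e => sqNormInt (e - t₂) = 18) = {ℓ} ∧
      (0 < dist (nb x t₂) (nb x ℓ) ∧ dist (nb x t₂) (nb x ℓ) ≤ 28 / 25) ∧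
      sqNormInt (zlab Pc nb (nb x t₂) (nb x ℓ) - zlab Pc nb (nb x t₂) x) = 18 ∧
      zlab Pc nb (nb x t₂) (nb x ℓ) ∈ lowerCap (Pc (nb x t₂)) (Jstep Pc nb ⟨x, t₁, t₂, U⟩).t₁
        (Jstep Pc nb ⟨x, t₁, t₂, U⟩).t₂ (Jstep Pc nb ⟨x, t₁, t₂, U⟩).U := by
  obtain ⟨hyS, hbxy, hwP, -, hvP, hvnb, hnw, hnv, hDwv, hκ, -, -, -, c₂, hc₂U, hc₂t, -, hbu,
    -, hUeq, -⟩ := Jstep_spec hch hx hU hreg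
  obtain ⟨h12, hhex, hUP, hoff, c, hcU, hform⟩ := hU
  have hPx := pattern_cases hch hx
  have hPy := pattern_cases hch hyS
  have ht₁ : t₁ ∈ Pc x := hhex (mem_hexLabels_iff.2 (Or.inl rfl))
  have ht₂ : t₂ ∈ Pc x := hhex (mem_hexLabels_iff.2 (Or.inr (Or.inl rfl)))
  have ht21 : t₂ - t₁ ∈ Pc x := hhex (mem_hexLabels_iff.2 (Or.inr (Or.inr (Or.inl rfl))))
  have hcP : c ∈ Pc x := hUP hcU
  have hc : c ∉ hexLabels t₁ t₂ := hoff c hcU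
  have key : ∃ ℓ ∈ lowerCap (Pc x) t₁ t₂ U, sqNormInt (ℓ - t₂) = 18 ∧
      (lowerCap (Pc x) t₁ t₂ U).filter (fun e => sqNormInt (e - t₂) = 18) = {ℓ} ∧
      ∀ e ∈ U, sqNormInt (e - t₂) = 18 → (sqNormInt (ℓ - e) ≠ 0 ∧ sqNormInt (ℓ - e) ≠ 18) := by
    rcases hform with hE | hO
    · have hc1 : c - t₁ ∈ Pc x := hUP (by rw [hE]; simp)
      have hc2 : c - t₂ ∈ Pc x := hUP (by rw [hE]; simp)
      rw [hE]
      exact (lowerRef_evenCap (Pc x) hPx t₁ ht₁ t₂ ht₂ c hcP h12 hhex hc hc1 hc2).2.1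
    · have hc1 : c + t₁ ∈ Pc x := hUP (by rw [hO]; simp)
      have hc2 : c + t₂ ∈ Pc x := hUP (by rw [hO]; simp)
      rw [hO]
      exact (lowerRef_oddCap (Pc x) hPx t₁ ht₁ t₂ ht₂ c hcP h12 hhex hc hc1 hc2).2.1
  obtain ⟨ℓ, hℓL, hℓt, hfilt, hcross⟩ := key
  obtain ⟨hℓP, hℓhex, -⟩ := mem_lowerCap_iff.1 hℓL
  have hz := nb_mem hch hx hℓP
  have hbz : 0 < dist (nb x t₂) (nb x ℓ) ∧ dist (nb x t₂) (nb x ℓ) ≤ 28 / 25 :=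
    (bond_nb_iff hch hx ht₂ hℓP).2 (by rw [sqNormInt_sub_comm]; exact hℓt)
  have hlam := zlab_spec hch hyS hz.1 hbz
  have Dlamw : sqNormInt (zlab Pc nb (nb x t₂) (nb x ℓ) - zlab Pc nb (nb x t₂) x) = 18 := by
    rw [transfer_nb_centre hch hx hyS hbxy hℓP hbz]; exact (hch x hx).sqNormInt_eq hℓP
  have Dlamμ : sqNormInt (zlab Pc nb (nb x t₂) (nb x ℓ) - zlab Pc nb (nb x t₂) (nb x c₂)) ≠ 0 ∧
      sqNormInt (zlab Pc nb (nb x t₂) (nb x ℓ) - zlab Pc nb (nb x t₂) (nb x c₂)) ≠ 18 := by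
    rw [transfer_nb_nb hch hx hyS hbxy hℓP (hUP hc₂U) hbz hbu]; exact hcross c₂ hc₂U hc₂t
  have hK : nb (nb x t₂) (zlab Pc nb (nb x t₂) x - zlab Pc nb (nb x t₂) (nb x t₁)) =
      nb x (t₂ - t₁) := by
    rw [← hκ]
    refine (zlab_spec hch hyS (nb_mem hch hx ht21).1 ((bond_nb_iff hch hx ht₂ ht21).2 ?_)).2
    exact (dist_hexagon (Pc x) hPx t₁ ht₁ t₂ ht₂ h12 hhex).2.2.2.2.2.2.1
  have hnothex : zlab Pc nb (nb x t₂) (nb x ℓ) ∉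
      hexLabels (Jstep Pc nb ⟨x, t₁, t₂, U⟩).t₁ (Jstep Pc nb ⟨x, t₁, t₂, U⟩).t₂ := by
    intro hmem
    rcases hex_touching_w_J (Pc (nb x t₂)) hPy _ hwP _ hvP hnw hnv hDwv _ hmem Dlamw with h | h
    · have e1 : nb x ℓ = nb x t₁ := by rw [← hlam.2, h, hvnb]
      exact hℓhex (by rw [nb_inj hch hx hℓP ht₁ e1]; exact mem_hexLabels_iff.2 (Or.inl rfl))
    · have e1 : nb x ℓ = nb x (t₂ - t₁) := by rw [← hlam.2, h, hK]
      exact hℓhex (by rw [nb_inj hch hx hℓP ht21 e1]; exact mem_hexLabels_iff.2 (Or.inr (Or.inr (Or.inl rfl))))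
  have hnotU : zlab Pc nb (nb x t₂) (nb x ℓ) ∉ (Jstep Pc nb ⟨x, t₁, t₂, U⟩).U := by
    rw [hUeq]; exact not_mem_capWithAny_singleton Dlamμ.1 Dlamμ.2
  exact ⟨ℓ, hℓL, hℓt, hfilt, hbz, Dlamw, mem_lowerCap_iff.2 ⟨hlam.1, hnothex, hnotU⟩⟩

/-- **Lower reference of the I⁻¹-step** (the unique lower-cap label touching `−t₁`). [folklore] -/
theorem IinvStep_lower (hch : ∀ z ∈ S, IsZChart S z (ac z) (Pc z) (Ac z) (nb z)) {x : (EuclideanSpace ℝ (Fin 3))}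
    (hx : x ∈ S) {t₁ t₂ : Fin 3 → ℤ} {U : Finset (Fin 3 → ℤ)} (hU : IsFrame (Pc x) t₁ t₂ U)
    (hreg : Pc (nb x (-t₁)) = fcc3Int ∨ Pc x = hcpInt ∨
      (-zlab Pc nb (nb x (-t₁)) x ∈ Pc (nb x (-t₁)) ∧
        -zlab Pc nb (nb x (-t₁)) (nb x (t₂ - t₁)) ∈ Pc (nb x (-t₁)))) :
    ∃ ℓ ∈ lowerCap (Pc x) t₁ t₂ U, sqNormInt (ℓ + t₁) = 18 ∧
      (lowerCap (Pc x) t₁ t₂ U).filter (fun e => sqNormInt (e + t₁) = 18) = {ℓ} ∧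
      (0 < dist (nb x (-t₁)) (nb x ℓ) ∧ dist (nb x (-t₁)) (nb x ℓ) ≤ 28 / 25) ∧
      sqNormInt (zlab Pc nb (nb x (-t₁)) (nb x ℓ) - zlab Pc nb (nb x (-t₁)) x) = 18 ∧
      zlab Pc nb (nb x (-t₁)) (nb x ℓ) ∈ lowerCap (Pc (nb x (-t₁)))
        (IinvStep Pc nb ⟨x, t₁, t₂, U⟩).t₁ (IinvStep Pc nb ⟨x, t₁, t₂, U⟩).t₂
        (IinvStep Pc nb ⟨x, t₁, t₂, U⟩).U := by
  obtain ⟨hyS, hbxy, hwP, -, hvP, hvnb, hnw, hnv, hDwv, hκ, -, -, -, cm, hcmU, hcmt, -, hbu,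
    -, hUeq, -⟩ := IinvStep_spec hch hx hU hreg
  obtain ⟨h12, hhex, hUP, hoff, c, hcU, hform⟩ := hU
  have hPx := pattern_cases hch hx
  have hPy := pattern_cases hch hyS
  have ht₁ : t₁ ∈ Pc x := hhex (mem_hexLabels_iff.2 (Or.inl rfl))
  have ht₂ : t₂ ∈ Pc x := hhex (mem_hexLabels_iff.2 (Or.inr (Or.inl rfl)))
  have ht21 : t₂ - t₁ ∈ Pc x := hhex (mem_hexLabels_iff.2 (Or.inr (Or.inr (Or.inl rfl))))
  have hnt₁ : -t₁ ∈ Pc x := hhex (mem_hexLabels_iff.2 (Or.inr (Or.inr (Or.inr (Or.inl rfl)))))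
  have hnt₂ : -t₂ ∈ Pc x :=
    hhex (mem_hexLabels_iff.2 (Or.inr (Or.inr (Or.inr (Or.inr (Or.inl rfl))))))
  have hcP : c ∈ Pc x := hUP hcU
  have hc : c ∉ hexLabels t₁ t₂ := hoff c hcU
  have key : ∃ ℓ ∈ lowerCap (Pc x) t₁ t₂ U, sqNormInt (ℓ + t₁) = 18 ∧
      (lowerCap (Pc x) t₁ t₂ U).filter (fun e => sqNormInt (e + t₁) = 18) = {ℓ} ∧
      ∀ e ∈ U, sqNormInt (e + t₁) = 18 → (sqNormInt (ℓ - e) ≠ 0 ∧ sqNormInt (ℓ - e) ≠ 18) := by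
    rcases hform with hE | hO
    · have hc1 : c - t₁ ∈ Pc x := hUP (by rw [hE]; simp)
      have hc2 : c - t₂ ∈ Pc x := hUP (by rw [hE]; simp)
      rw [hE]
      exact (lowerRef_evenCap (Pc x) hPx t₁ ht₁ t₂ ht₂ c hcP h12 hhex hc hc1 hc2).2.2.1
    · have hc1 : c + t₁ ∈ Pc x := hUP (by rw [hO]; simp)
      have hc2 : c + t₂ ∈ Pc x := hUP (by rw [hO]; simp)
      rw [hO]
      exact (lowerRef_oddCap (Pc x) hPx t₁ ht₁ t₂ ht₂ c hcP h12 hhex hc hc1 hc2).2.2.1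
  obtain ⟨ℓ, hℓL, hℓt, hfilt, hcross⟩ := key
  obtain ⟨hℓP, hℓhex, -⟩ := mem_lowerCap_iff.1 hℓL
  have hz := nb_mem hch hx hℓP
  have hbz : 0 < dist (nb x (-t₁)) (nb x ℓ) ∧ dist (nb x (-t₁)) (nb x ℓ) ≤ 28 / 25 :=
    (bond_nb_iff hch hx hnt₁ hℓP).2 (by
      rw [show -t₁ - ℓ = -(ℓ + t₁) by abel, sqNormInt_neg]; exact hℓt)
  have hlam := zlab_spec hch hyS hz.1 hbz
  have Dlamw : sqNormInt (zlab Pc nb (nb x (-t₁)) (nb x ℓ) - zlab Pc nb (nb x (-t₁)) x) = 18 := by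
    rw [transfer_nb_centre hch hx hyS hbxy hℓP hbz]; exact (hch x hx).sqNormInt_eq hℓP
  have Dlamμ : sqNormInt (zlab Pc nb (nb x (-t₁)) (nb x ℓ) - zlab Pc nb (nb x (-t₁)) (nb x cm)) ≠ 0 ∧
      sqNormInt (zlab Pc nb (nb x (-t₁)) (nb x ℓ) - zlab Pc nb (nb x (-t₁)) (nb x cm)) ≠ 18 := by
    rw [transfer_nb_nb hch hx hyS hbxy hℓP (hUP hcmU) hbz hbu]; exact hcross cm hcmU hcmt
  have hK : nb (nb x (-t₁)) (zlab Pc nb (nb x (-t₁)) x - zlab Pc nb (nb x (-t₁)) (nb x (t₂ - t₁))) =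
      nb x (-t₂) := by
    rw [← hκ]
    refine (zlab_spec hch hyS (nb_mem hch hx hnt₂).1 ((bond_nb_iff hch hx hnt₁ hnt₂).2 ?_)).2
    rw [show -t₁ - -t₂ = t₂ - t₁ by abel, sqNormInt_sub_comm]; exact h12
  have hnothex : zlab Pc nb (nb x (-t₁)) (nb x ℓ) ∉
      hexLabels (IinvStep Pc nb ⟨x, t₁, t₂, U⟩).t₁ (IinvStep Pc nb ⟨x, t₁, t₂, U⟩).t₂ := by
    intro hmem
    rcases hex_touching_w_Iinv (Pc (nb x (-t₁))) hPy _ hwP _ hvP hnw hnv hDwv _ hmem Dlamw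
      with h | h
    · have e1 : nb x ℓ = nb x (t₂ - t₁) := by rw [← hlam.2, h, hvnb]
      exact hℓhex (by rw [nb_inj hch hx hℓP ht21 e1]; exact mem_hexLabels_iff.2 (Or.inr (Or.inr (Or.inl rfl))))
    · have e1 : nb x ℓ = nb x (-t₂) := by rw [← hlam.2, h, hK]
      exact hℓhex (by rw [nb_inj hch hx hℓP hnt₂ e1]; exact mem_hexLabels_iff.2 (Or.inr (Or.inr (Or.inr (Or.inr (Or.inl rfl))))))
  have hnotU : zlab Pc nb (nb x (-t₁)) (nb x ℓ) ∉ (IinvStep Pc nb ⟨x, t₁, t₂, U⟩).U := by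
    rw [hUeq]; exact not_mem_capWithAny_singleton Dlamμ.1 Dlamμ.2
  exact ⟨ℓ, hℓL, hℓt, hfilt, hbz, Dlamw, mem_lowerCap_iff.2 ⟨hlam.1, hnothex, hnotU⟩⟩

/-- **Lower reference of the J⁻¹-step** (the unique lower-cap label touching `−t₂`). [folklore] -/
theorem JinvStep_lower (hch : ∀ z ∈ S, IsZChart S z (ac z) (Pc z) (Ac z) (nb z)) {x : (EuclideanSpace ℝ (Fin 3))}
    (hx : x ∈ S) {t₁ t₂ : Fin 3 → ℤ} {U : Finset (Fin 3 → ℤ)} (hU : IsFrame (Pc x) t₁ t₂ U)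
    (hreg : Pc (nb x (-t₂)) = fcc3Int ∨ Pc x = hcpInt ∨
      (-zlab Pc nb (nb x (-t₂)) x ∈ Pc (nb x (-t₂)) ∧
        -zlab Pc nb (nb x (-t₂)) (nb x (t₁ - t₂)) ∈ Pc (nb x (-t₂)))) :
    ∃ ℓ ∈ lowerCap (Pc x) t₁ t₂ U, sqNormInt (ℓ + t₂) = 18 ∧
      (lowerCap (Pc x) t₁ t₂ U).filter (fun e => sqNormInt (e + t₂) = 18) = {ℓ} ∧
      (0 < dist (nb x (-t₂)) (nb x ℓ) ∧ dist (nb x (-t₂)) (nb x ℓ) ≤ 28 / 25) ∧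
      sqNormInt (zlab Pc nb (nb x (-t₂)) (nb x ℓ) - zlab Pc nb (nb x (-t₂)) x) = 18 ∧
      zlab Pc nb (nb x (-t₂)) (nb x ℓ) ∈ lowerCap (Pc (nb x (-t₂)))
        (JinvStep Pc nb ⟨x, t₁, t₂, U⟩).t₁ (JinvStep Pc nb ⟨x, t₁, t₂, U⟩).t₂
        (JinvStep Pc nb ⟨x, t₁, t₂, U⟩).U := by
  obtain ⟨hyS, hbxy, hwP, -, hvP, hvnb, hnw, hnv, hDwv, hκ, -, -, -, cm, hcmU, hcmt, -, hbu,
    -, hUeq, -⟩ := JinvStep_spec hch hx hU hreg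
  obtain ⟨h12, hhex, hUP, hoff, c, hcU, hform⟩ := hU
  have hPx := pattern_cases hch hx
  have hPy := pattern_cases hch hyS
  have ht₁ : t₁ ∈ Pc x := hhex (mem_hexLabels_iff.2 (Or.inl rfl))
  have ht₂ : t₂ ∈ Pc x := hhex (mem_hexLabels_iff.2 (Or.inr (Or.inl rfl)))
  have ht12 : t₁ - t₂ ∈ Pc x :=
    hhex (mem_hexLabels_iff.2 (Or.inr (Or.inr (Or.inr (Or.inr (Or.inr rfl))))))
  have hnt₁ : -t₁ ∈ Pc x := hhex (mem_hexLabels_iff.2 (Or.inr (Or.inr (Or.inr (Or.inl rfl)))))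
  have hnt₂ : -t₂ ∈ Pc x :=
    hhex (mem_hexLabels_iff.2 (Or.inr (Or.inr (Or.inr (Or.inr (Or.inl rfl))))))
  have hcP : c ∈ Pc x := hUP hcU
  have hc : c ∉ hexLabels t₁ t₂ := hoff c hcU
  have key : ∃ ℓ ∈ lowerCap (Pc x) t₁ t₂ U, sqNormInt (ℓ + t₂) = 18 ∧
      (lowerCap (Pc x) t₁ t₂ U).filter (fun e => sqNormInt (e + t₂) = 18) = {ℓ} ∧
      ∀ e ∈ U, sqNormInt (e + t₂) = 18 → (sqNormInt (ℓ - e) ≠ 0 ∧ sqNormInt (ℓ - e) ≠ 18) := by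
    rcases hform with hE | hO
    · have hc1 : c - t₁ ∈ Pc x := hUP (by rw [hE]; simp)
      have hc2 : c - t₂ ∈ Pc x := hUP (by rw [hE]; simp)
      rw [hE]
      exact (lowerRef_evenCap (Pc x) hPx t₁ ht₁ t₂ ht₂ c hcP h12 hhex hc hc1 hc2).2.2.2
    · have hc1 : c + t₁ ∈ Pc x := hUP (by rw [hO]; simp)
      have hc2 : c + t₂ ∈ Pc x := hUP (by rw [hO]; simp)
      rw [hO]
      exact (lowerRef_oddCap (Pc x) hPx t₁ ht₁ t₂ ht₂ c hcP h12 hhex hc hc1 hc2).2.2.2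
  obtain ⟨ℓ, hℓL, hℓt, hfilt, hcross⟩ := key
  obtain ⟨hℓP, hℓhex, -⟩ := mem_lowerCap_iff.1 hℓL
  have hz := nb_mem hch hx hℓP
  have hbz : 0 < dist (nb x (-t₂)) (nb x ℓ) ∧ dist (nb x (-t₂)) (nb x ℓ) ≤ 28 / 25 :=
    (bond_nb_iff hch hx hnt₂ hℓP).2 (by
      rw [show -t₂ - ℓ = -(ℓ + t₂) by abel, sqNormInt_neg]; exact hℓt)
  have hlam := zlab_spec hch hyS hz.1 hbz
  have Dlamw : sqNormInt (zlab Pc nb (nb x (-t₂)) (nb x ℓ) - zlab Pc nb (nb x (-t₂)) x) = 18 := by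
    rw [transfer_nb_centre hch hx hyS hbxy hℓP hbz]; exact (hch x hx).sqNormInt_eq hℓP
  have Dlamμ : sqNormInt (zlab Pc nb (nb x (-t₂)) (nb x ℓ) - zlab Pc nb (nb x (-t₂)) (nb x cm)) ≠ 0 ∧
      sqNormInt (zlab Pc nb (nb x (-t₂)) (nb x ℓ) - zlab Pc nb (nb x (-t₂)) (nb x cm)) ≠ 18 := by
    rw [transfer_nb_nb hch hx hyS hbxy hℓP (hUP hcmU) hbz hbu]; exact hcross cm hcmU hcmt
  have hK : nb (nb x (-t₂)) (zlab Pc nb (nb x (-t₂)) x - zlab Pc nb (nb x (-t₂)) (nb x (t₁ - t₂))) =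
      nb x (-t₁) := by
    rw [← hκ]
    refine (zlab_spec hch hyS (nb_mem hch hx hnt₁).1 ((bond_nb_iff hch hx hnt₂ hnt₁).2 ?_)).2
    rw [show -t₂ - -t₁ = t₁ - t₂ by abel]; exact h12
  have hnothex : zlab Pc nb (nb x (-t₂)) (nb x ℓ) ∉
      hexLabels (JinvStep Pc nb ⟨x, t₁, t₂, U⟩).t₁ (JinvStep Pc nb ⟨x, t₁, t₂, U⟩).t₂ := by
    intro hmem
    rcases hex_touching_w_Jinv (Pc (nb x (-t₂))) hPy _ hwP _ hvP hnw hnv hDwv _ hmem Dlamw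
      with h | h
    · have e1 : nb x ℓ = nb x (t₁ - t₂) := by rw [← hlam.2, h, hvnb]
      exact hℓhex (by rw [nb_inj hch hx hℓP ht12 e1]; exact mem_hexLabels_iff.2 (Or.inr (Or.inr (Or.inr (Or.inr (Or.inr rfl))))))
    · have e1 : nb x ℓ = nb x (-t₁) := by rw [← hlam.2, h, hK]
      exact hℓhex (by rw [nb_inj hch hx hℓP hnt₁ e1]; exact mem_hexLabels_iff.2 (Or.inr (Or.inr (Or.inr (Or.inl rfl)))))
  have hnotU : zlab Pc nb (nb x (-t₂)) (nb x ℓ) ∉ (JinvStep Pc nb ⟨x, t₁, t₂, U⟩).U := by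
    rw [hUeq]; exact not_mem_capWithAny_singleton Dlamμ.1 Dlamμ.2
  exact ⟨ℓ, hℓL, hℓt, hfilt, hbz, Dlamw, mem_lowerCap_iff.2 ⟨hlam.1, hnothex, hnotU⟩⟩

end Summit.AtomisticToContinuum.Crystallization.Theorems.PalmUnimodularRigidityShellsToBarlowChart

end
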